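import Literature.NumberTheory.Automorphic.UnitaryUnitOrbitalIntegralFixedPoints      -- ★ F0P3-p01 (g12): the `H_v` socket `…_prod_eq_natCard_fixedBy` (L2 dress) over ★ p839788
import Literature.NumberTheory.Automorphic.UnitaryGroupIntegralPointsReductionInert   -- ★ `valuation_galAdicCompletionMap_eq` (σ_w preserves the valuation at a non-split `w`)
import Literature.NumberTheory.Automorphic.CompactCoreCentralizerUnitary              -- ★ `centralizer_prod_singleton`
import Literature.MeasureTheory.Group.InvariantQuotientProd                           -- ★ `prodEquiv_smul` (equivariance of Mathlib `QuotientGroup.prodEquiv`)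
import HarnessLib

/-!
# The `H`-side fixed-point socket of the inert unit fundamental lemma, FACTORED: `#Fix_{γ_H}(H_v ⧸ K_{H,v}) = #Fix_{γ₂}(U(Φ₂)_v ⧸ K₂)` —
# fixed points on a product of coset spaces multiply, and the rank-one factor `U(Φ₁)(L⁺_v) ⧸ U(Φ₁)(𝒪_v)` is ONE point at a non-split place

Topic `NumberTheory/Automorphic`; namespaces `Literature.NumberTheory.Automorphic` (§1–§2, generic) and `….UnitaryGroup` (§3–§5).  THEOREMS ONLY (no definition,
no instance, no notation, no named fact, no `sorry`).  Cell `hodgecm-mathlib`, F0∕P3a N7-inert road (A-p06 map 84809157 §3 (L2)∕(L5)), brick «(L2)-PAIR» (LEAD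
F0P3a-plan (g9) T8-26; A-p01 (g20)).  HONEST LABEL: count-neutral plumbing — the `H_v` socket itself is ★ `UnitaryUnitOrbitalIntegralFixedPoints` §3
(F0P3-p01 (g12): `Φ([γ_H], 1_{K₂ ×ˢ K₁}; m_H) = #Fix_{γ_H}((U(Φ₂)_v × U(Φ₁)_v) ⧸ (K₂ ×ˢ K₁))`); this file supplies what the held (L5) rank-2 count [Rogawski1990,
Lemma 4.9.3 «techniques of [LL] … omitted»; acq-15093] will read: the count on the PAIR quotient is the count on the `U(Φ₂)` quotient alone.  HC_CM is proved only
modulo the printed citations until rung 0 closes.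

* §1 GENERIC (groups `A B`, subgroups `K_A K_B`, left multiplication on coset spaces): **`natCard_fixedBy_quotient_prod`** (`#Fix_{(a,b)}((A × B) ⧸ (K_A ×ˢ K_B)) =
  #Fix_a(A ⧸ K_A) · #Fix_b(B ⧸ K_B)`, the bijection built in the proof along Mathlib `QuotientGroup.prodEquiv`, equivariant by ★ `prodEquiv_smul`),
  `natCard_fixedBy_quotient_top` (`= 1`), `natCard_fixedBy_quotient_prod_of_eq_top`.
* §2 `compactSpace_centralizer_prod` — `Z((a, b)) = Z(a) × Z(b)` (★ `centralizer_prod_singleton`) is compact when both factors are.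
* §3 RANK ONE AT A NON-SPLIT PLACE (`E ∕ F` quadratic, `c • w = w`): **`localIntegralLevel_one_eq_top_of_smul_eq`** — `U(J)(F_v) = U(J)(𝒪_v)` for every
  `J ∈ M₁(E)` invertible at `w`: a 1×1 unitary `x` has `σ_w(x) x = 1`, `σ_w` preserves the valuation (★ `valuation_galAdicCompletionMap_eq`), so `v(x) = 1` and
  `x ∈ GL₁(𝒪_w)` (★ `mem_glInt_iff`, ★ `mem_localIntegralLevel_iff_of_smul_eq`) — «`E_w¹ ⊆ 𝒪_wˣ`»; CM dress `cmLocalIntegralLevel_one_eq_top_of_smul_eq`,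
  `compactSpace_cmDatum_local_one_of_smul_eq` (`U(H₁)(L⁺_v)` is compact).
* §4 THE SOCKET, FACTORED: **`natCard_fixedBy_cmLocalIntegralLevel_prod_eq_of_smul_eq`** (any `N₂`, `H₂`; `H₁ ∈ M₁(L)` invertible at `w`, `c • w = w`).
* §5 Composed with ★ F0P3-p01 §3 at the letter's carriers `Φ₂, Φ₁`: **`classOrbitalIntegral_indicator_cmLocalIntegralLevel_prod_eq_natCard_fixedBy_fst`**
  (+ `_complex_`) — `Φ([γ_H], 1_{K_{H,v}}; m_H) = #Fix_{γ₂}(U(Φ₂)_v ⧸ K₂)` with the compactness of `Z(γ_H)` DERIVED from that of `Z(γ₂)` (§2 + §3): the binder is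
  `[CompactSpace Z(γ₂)]`, not `[CompactSpace Z(γ_H)]`.

References: [Rogawski1990] §3.6 p. 31 (torus types), §4.9 Prop. 4.9.1 (b) p. 55, Lemma 4.9.3 p. 61; [Laumon1995] Lemma (5.3.2) p. 136; [PlatonovRapinchuk1994] §5.1;
[BourbakiGT1] Ch. III §2; [CasselsFrohlichANT1967] Ch. VII §1.1.
-/

set_option autoImplicit false

noncomputable section

open MeasureTheory Measure Topology Set Filter Function NumberField IsDedekindDomain
open scoped ENNReal NNReal Matrix MatrixGroups
open Literature.NumberTheory.Rogawski1990

namespace Literature.NumberTheory.Automorphic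

/-! ## §1 Fixed points on a product of coset spaces -/

section Product

variable {A B : Type*} [Group A] [Group B] (KA : Subgroup A) (KB : Subgroup B)

/-- **`#Fix_{(a,b)}((A × B) ⧸ (K_A ×ˢ K_B)) = #Fix_a(A ⧸ K_A) · #Fix_b(B ⧸ K_B)`**: fixed points of `(a, b)` on the product coset space correspond, along
Mathlib `QuotientGroup.prodEquiv` (equivariant: ★ `prodEquiv_smul`), to pairs of fixed points. [cite: BourbakiGT1, Ch. III §2] -/
theorem natCard_fixedBy_quotient_prod (a : A) (b : B) :
    Nat.card (MulAction.fixedBy ((A × B) ⧸ KA.prod KB) (a, b)) =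
      Nat.card (MulAction.fixedBy (A ⧸ KA) a) * Nat.card (MulAction.fixedBy (B ⧸ KB) b) := by
  let e : MulAction.fixedBy ((A × B) ⧸ KA.prod KB) (a, b) ≃ MulAction.fixedBy (A ⧸ KA) a × MulAction.fixedBy (B ⧸ KB) b :=
    { toFun := fun x => (⟨(QuotientGroup.prodEquiv KA KB x.1).1, by
          have h := congrArg (fun y => (QuotientGroup.prodEquiv KA KB y).1) x.2
          simp only [Literature.MeasureTheory.Group.prodEquiv_smul] at h
          exact h⟩,
        ⟨(QuotientGroup.prodEquiv KA KB x.1).2, by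
          have h := congrArg (fun y => (QuotientGroup.prodEquiv KA KB y).2) x.2
          simp only [Literature.MeasureTheory.Group.prodEquiv_smul] at h
          exact h⟩)
      invFun := fun p => ⟨(QuotientGroup.prodEquiv KA KB).symm ((p.1 : A ⧸ KA), (p.2 : B ⧸ KB)), by
          show (a, b) • (QuotientGroup.prodEquiv KA KB).symm ((p.1 : A ⧸ KA), (p.2 : B ⧸ KB)) = _
          apply (QuotientGroup.prodEquiv KA KB).injective
          rw [Literature.MeasureTheory.Group.prodEquiv_smul, Equiv.apply_symm_apply]
          exact Prod.ext p.1.2 p.2.2⟩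
      left_inv := fun x => Subtype.ext ((QuotientGroup.prodEquiv KA KB).symm_apply_apply x.1)
      right_inv := fun p => by
        refine Prod.ext (Subtype.ext ?_) (Subtype.ext ?_) <;>
          simp only [Equiv.apply_symm_apply] }
  rw [Nat.card_congr e, Nat.card_prod]

/-- On the one-point coset space `B ⧸ B` every element has exactly ONE fixed point. [cite: BourbakiGT1, Ch. III §2] -/
theorem natCard_fixedBy_quotient_top (b : B) : Nat.card (MulAction.fixedBy (B ⧸ (⊤ : Subgroup B)) b) = 1 := by
  haveI : Subsingleton (B ⧸ (⊤ : Subgroup B)) := QuotientGroup.subsingleton_quotient_top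
  have hmem : ((QuotientGroup.mk 1 : B ⧸ (⊤ : Subgroup B))) ∈ MulAction.fixedBy (B ⧸ (⊤ : Subgroup B)) b := Subsingleton.elim _ _
  haveI : Unique (MulAction.fixedBy (B ⧸ (⊤ : Subgroup B)) b) :=
    { default := ⟨_, hmem⟩, uniq := fun x => Subtype.ext (Subsingleton.elim _ _) }
  exact Nat.card_unique

/-- **When the second level is everything** (`K_B = B`): `#Fix_{(a,b)}((A × B) ⧸ (K_A ×ˢ B)) = #Fix_a(A ⧸ K_A)` — «the second factor contributes `1`».
[cite: BourbakiGT1, Ch. III §2] -/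
theorem natCard_fixedBy_quotient_prod_of_eq_top (hKB : KB = ⊤) (a : A) (b : B) :
    Nat.card (MulAction.fixedBy ((A × B) ⧸ KA.prod KB) (a, b)) = Nat.card (MulAction.fixedBy (A ⧸ KA) a) := by
  subst hKB
  rw [natCard_fixedBy_quotient_prod, natCard_fixedBy_quotient_top, mul_one]

end Product

/-! ## §2 The centraliser of a pair is compact when both centralisers are -/

section CompactPair

variable {A B : Type*} [Group A] [Group B] [TopologicalSpace A] [TopologicalSpace B]

/-- `Z((a, b)) = Z(a) × Z(b)` (★ `centralizer_prod_singleton`) is compact when `Z(a)` and `Z(b)` are. [cite: BourbakiGT1, Ch. III §2] -/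
theorem compactSpace_centralizer_prod (a : A) (b : B) [CompactSpace (Subgroup.centralizer ({a} : Set A))]
    [CompactSpace (Subgroup.centralizer ({b} : Set B))] : CompactSpace (Subgroup.centralizer ({(a, b)} : Set (A × B))) := by
  have hA : IsCompact ((Subgroup.centralizer ({a} : Set A) : Subgroup A) : Set A) := isCompact_iff_compactSpace.2 ‹_›
  have hB : IsCompact ((Subgroup.centralizer ({b} : Set B) : Subgroup B) : Set B) := isCompact_iff_compactSpace.2 ‹_›
  have h := hA.prod hB
  rw [← Subgroup.coe_prod, ← centralizer_prod_singleton] at h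
  exact isCompact_iff_compactSpace.1 h

end CompactPair



/-! ## §3 Rank one at a non-split place: `U(J)(F_v) = U(J)(𝒪_v)` -/

namespace UnitaryGroup

section RankOne

open ValuativeRel

/-- For a 1×1 `σ`-unitary `g` (`ᵗ(σg) J g = J`, `J` invertible): `σ(g₀₀) · g₀₀ = 1`. [cite: PlatonovRapinchuk1994, §5.1] -/
private theorem map_apply_mul_apply_eq_one {K : Type*} [Field K] (σ : K →+* K) {J : Matrix (Fin 1) (Fin 1) K} (hJ : IsUnit J)
    {g : GL (Fin 1) K} (hg : g ∈ unitaryGroupOfForm σ J) :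
    σ (((g : GL (Fin 1) K) : Matrix (Fin 1) (Fin 1) K) 0 0) * ((g : GL (Fin 1) K) : Matrix (Fin 1) (Fin 1) K) 0 0 = 1 := by
  rw [mem_unitaryGroupOfForm_iff] at hg
  have h := congrArg (fun M : Matrix (Fin 1) (Fin 1) K => M 0 0) hg
  simp only [Matrix.mul_apply, Fin.sum_univ_one, Matrix.transpose_apply, Matrix.map_apply] at h
  have hJ0 : J 0 0 ≠ 0 := by
    rw [← Matrix.det_fin_one J]
    exact ((Matrix.isUnit_iff_isUnit_det J).1 hJ).ne_zero
  have h' : σ (((g : GL (Fin 1) K) : Matrix (Fin 1) (Fin 1) K) 0 0) * ((g : GL (Fin 1) K) : Matrix (Fin 1) (Fin 1) K) 0 0 * J 0 0 = 1 * J 0 0 := by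
    rw [one_mul, mul_right_comm]; exact h
  exact mul_right_cancel₀ hJ0 h'

/-- For a 1×1 `σ`-unitary `g` over a valued field with `v ∘ σ = v`: `v(g₀₀) ≤ 1`. [cite: PlatonovRapinchuk1994, §5.1] -/
private theorem valuation_apply_le_one {K : Type*} [Field K] [ValuativeRel K] (σ : K →+* K) (hσ : ∀ x, valuation K (σ x) = valuation K x)
    {J : Matrix (Fin 1) (Fin 1) K} (hJ : IsUnit J) {g : GL (Fin 1) K} (hg : g ∈ unitaryGroupOfForm σ J) :
    valuation K (((g : GL (Fin 1) K) : Matrix (Fin 1) (Fin 1) K) 0 0) ≤ 1 := by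
  have h := congrArg (valuation K) (map_apply_mul_apply_eq_one σ hJ hg)
  rw [map_mul, map_one, hσ] at h
  rcases le_total (valuation K (((g : GL (Fin 1) K) : Matrix (Fin 1) (Fin 1) K) 0 0)) 1 with hle | hge
  · exact hle
  · calc valuation K (((g : GL (Fin 1) K) : Matrix (Fin 1) (Fin 1) K) 0 0)
          = valuation K (((g : GL (Fin 1) K) : Matrix (Fin 1) (Fin 1) K) 0 0) * 1 := (mul_one _).symm
      _ ≤ valuation K (((g : GL (Fin 1) K) : Matrix (Fin 1) (Fin 1) K) 0 0) *
            valuation K (((g : GL (Fin 1) K) : Matrix (Fin 1) (Fin 1) K) 0 0) := mul_le_mul' le_rfl hge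
      _ = 1 := h

variable {F E : Type} [Field F] [NumberField F] [Field E] [NumberField E] [Algebra F E] [Algebra.IsQuadraticExtension F E]
  (c : E ≃ₐ[F] E) (J : Matrix (Fin 1) (Fin 1) E) {v : HeightOneSpectrum (𝓞 F)}

/-- **`U(J)(F_v) = U(J)(𝒪_v)` IN RANK ONE AT A NON-SPLIT PLACE**: for `E ∕ F` quadratic, `J ∈ M₁(E)` invertible at the place `w ∣ v` with `c • w = w`, every
`g ∈ U(J)(F_v)` lies in the integral level ★ `localIntegralLevel` — its avatar `g_w ∈ U(σ_w, J_w)(E_w)` (★ `localNonsplitEquiv`) is a norm-one scalar,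
`σ_w(g_w) g_w = 1`, and `σ_w` preserves the valuation (★ `valuation_galAdicCompletionMap_eq`), so `v(g_w) = v(g_w⁻¹) = 1` and `g_w ∈ GL₁(𝒪_w)` (★ `mem_glInt_iff`,
★ `mem_localIntegralLevel_iff_of_smul_eq`): «`E_w¹ ⊆ 𝒪_wˣ`». [cite: PlatonovRapinchuk1994, §5.1] [cite: CasselsFrohlichANT1967, Ch. VII §1.1] -/
theorem localIntegralLevel_one_eq_top_of_smul_eq (hc : c ≠ 1) (w : PlacesOver E v) (hw : c • w.1 = w.1) (hJw : IsUnit (placeForm J w.1)) :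
    localIntegralLevel c 1 J v = ⊤ := by
  refine eq_top_iff.2 fun g _ => ?_
  rw [mem_localIntegralLevel_iff_of_smul_eq c 1 J hc w hw g, mem_glInt_iff]
  have hσ : ∀ x, valuation (w.1.adicCompletion E) (galAdicCompletionMap (L := E) c hw x) = valuation (w.1.adicCompletion E) x :=
    valuation_galAdicCompletionMap_eq c v w hw
  have hx := (localNonsplitEquiv c J hc w hw g).2
  have hx' : ((localNonsplitEquiv c J hc w hw g : unitaryGroupOfForm (galAdicCompletionMap (L := E) c hw) (placeForm J w.1)) :
      GL (Fin 1) (w.1.adicCompletion E))⁻¹ ∈ unitaryGroupOfForm (galAdicCompletionMap (L := E) c hw) (placeForm J w.1) :=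
    Subgroup.inv_mem _ hx
  refine ⟨fun i j => ?_, fun i j => ?_⟩
  · fin_cases i; fin_cases j
    exact (Valuation.mem_integer_iff _ _).2 (valuation_apply_le_one _ hσ hJw hx)
  · fin_cases i; fin_cases j
    exact (Valuation.mem_integer_iff _ _).2 (valuation_apply_le_one _ hσ hJw hx')

end RankOne

/-! ## §4 The CM dress: the `U(Φ₁)` factor of the `H`-side socket contributes `1` -/

section CM

variable (L : Type) [Field L] [NumberField L] [IsCMField L]

/-- **`U(H₁)(L⁺_v) = U(H₁)(𝒪_v)`** for `H₁ ∈ M₁(L)` invertible at a non-split place `w ∣ v` (`c • w = w`, `c` = complex conjugation): ★ `cmLocalIntegralLevel L 1 H₁ v = ⊤`.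
[cite: PlatonovRapinchuk1994, §5.1] -/
theorem cmLocalIntegralLevel_one_eq_top_of_smul_eq (H₁ : Matrix (Fin 1) (Fin 1) L) {v : HeightOneSpectrum (𝓞 ↥(maximalRealSubfield L))}
    (w : PlacesOver L v) (hw : IsCMField.complexConj L • w.1 = w.1) (hH₁w : IsUnit (placeForm H₁ w.1)) :
    cmLocalIntegralLevel L 1 H₁ v = ⊤ :=
  localIntegralLevel_one_eq_top_of_smul_eq (IsCMField.complexConj L) H₁ (IsCMField.complexConj_ne_one L) w hw hH₁w

/-- Hence `U(H₁)(L⁺_v)` is COMPACT at a non-split place (it equals its compact open level ★ `isCompact_isOpen_cmLocalIntegralLevel`). [cite: PlatonovRapinchuk1994, §5.1] -/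
theorem compactSpace_cmDatum_local_one_of_smul_eq (H₁ : Matrix (Fin 1) (Fin 1) L) {v : HeightOneSpectrum (𝓞 ↥(maximalRealSubfield L))}
    (w : PlacesOver L v) (hw : IsCMField.complexConj L • w.1 = w.1) (hH₁w : IsUnit (placeForm H₁ w.1)) :
    CompactSpace ((cmDatum L 1 H₁).Local v) := by
  refine ⟨?_⟩
  have h := (isCompact_isOpen_cmLocalIntegralLevel L 1 H₁ v).1
  rwa [cmLocalIntegralLevel_one_eq_top_of_smul_eq L H₁ w hw hH₁w, Subgroup.coe_top] at h

/-- **THE `H`-SIDE SOCKET FACTORS**: at a non-split place, for `H₁ ∈ M₁(L)` invertible at `w`, every `γ_H = (γ₂, γ₁) ∈ U(H₂)(L⁺_v) × U(H₁)(L⁺_v)`: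
`#Fix_{γ_H}((U(H₂)_v × U(H₁)_v) ⧸ (K₂ ×ˢ K₁)) = #Fix_{γ₂}(U(H₂)_v ⧸ K₂)` (§1 with `K₁ = U(H₁)_v`, §3). [cite: Rogawski1990, §4.9 Prop. 4.9.1 (b) p. 55] [cite: BourbakiGT1, Ch. III §2] -/
theorem natCard_fixedBy_cmLocalIntegralLevel_prod_eq_of_smul_eq (N₂ : ℕ) (H₂ : Matrix (Fin N₂) (Fin N₂) L) (H₁ : Matrix (Fin 1) (Fin 1) L)
    {v : HeightOneSpectrum (𝓞 ↥(maximalRealSubfield L))} (w : PlacesOver L v) (hw : IsCMField.complexConj L • w.1 = w.1) (hH₁w : IsUnit (placeForm H₁ w.1))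
    (γ : (cmDatum L N₂ H₂).Local v × (cmDatum L 1 H₁).Local v) :
    Nat.card (MulAction.fixedBy (((cmDatum L N₂ H₂).Local v × (cmDatum L 1 H₁).Local v) ⧸
        (cmLocalIntegralLevel L N₂ H₂ v).prod (cmLocalIntegralLevel L 1 H₁ v)) γ) =
      Nat.card (MulAction.fixedBy ((cmDatum L N₂ H₂).Local v ⧸ cmLocalIntegralLevel L N₂ H₂ v) γ.1) :=
  natCard_fixedBy_quotient_prod_of_eq_top (cmLocalIntegralLevel L N₂ H₂ v) (cmLocalIntegralLevel L 1 H₁ v)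
    (cmLocalIntegralLevel_one_eq_top_of_smul_eq L H₁ w hw hH₁w) γ.1 γ.2

end CM

/-! ## §5 The LEAD's composite: the `H`-side socket at the letter carriers `Φ₂, Φ₁`, non-split `v`, reads `#Fix_{γ₂}(U(Φ₂)_v ⧸ K₂)` -/

section H

variable (L : Type) [Field L] [NumberField L] [IsCMField L] (v : HeightOneSpectrum (𝓞 ↥(maximalRealSubfield L)))
  [MeasurableSpace ((cmDatum L 2 (Matrix.of fun i j : Fin 2 => if i.val + j.val + 1 = 2 then (1 : L) else 0)).Local v × (cmDatum L 1 (Matrix.of fun i j : Fin 1 => if i.val + j.val + 1 = 1 then (1 : L) else 0)).Local v)]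
  [BorelSpace ((cmDatum L 2 (Matrix.of fun i j : Fin 2 => if i.val + j.val + 1 = 2 then (1 : L) else 0)).Local v × (cmDatum L 1 (Matrix.of fun i j : Fin 1 => if i.val + j.val + 1 = 1 then (1 : L) else 0)).Local v)]
  [∀ a : (cmDatum L 2 (Matrix.of fun i j : Fin 2 => if i.val + j.val + 1 = 2 then (1 : L) else 0)).Local v × (cmDatum L 1 (Matrix.of fun i j : Fin 1 => if i.val + j.val + 1 = 1 then (1 : L) else 0)).Local v,
    MeasurableSpace (((cmDatum L 2 (Matrix.of fun i j : Fin 2 => if i.val + j.val + 1 = 2 then (1 : L) else 0)).Local v × (cmDatum L 1 (Matrix.of fun i j : Fin 1 => if i.val + j.val + 1 = 1 then (1 : L) else 0)).Local v) ⧸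
      Subgroup.centralizer ({a} : Set ((cmDatum L 2 (Matrix.of fun i j : Fin 2 => if i.val + j.val + 1 = 2 then (1 : L) else 0)).Local v × (cmDatum L 1 (Matrix.of fun i j : Fin 1 => if i.val + j.val + 1 = 1 then (1 : L) else 0)).Local v)))]
  [∀ a : (cmDatum L 2 (Matrix.of fun i j : Fin 2 => if i.val + j.val + 1 = 2 then (1 : L) else 0)).Local v × (cmDatum L 1 (Matrix.of fun i j : Fin 1 => if i.val + j.val + 1 = 1 then (1 : L) else 0)).Local v,
    BorelSpace (((cmDatum L 2 (Matrix.of fun i j : Fin 2 => if i.val + j.val + 1 = 2 then (1 : L) else 0)).Local v × (cmDatum L 1 (Matrix.of fun i j : Fin 1 => if i.val + j.val + 1 = 1 then (1 : L) else 0)).Local v) ⧸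
      Subgroup.centralizer ({a} : Set ((cmDatum L 2 (Matrix.of fun i j : Fin 2 => if i.val + j.val + 1 = 2 then (1 : L) else 0)).Local v × (cmDatum L 1 (Matrix.of fun i j : Fin 1 => if i.val + j.val + 1 = 1 then (1 : L) else 0)).Local v)))]
  (νH : Measure ((cmDatum L 2 (Matrix.of fun i j : Fin 2 => if i.val + j.val + 1 = 2 then (1 : L) else 0)).Local v × (cmDatum L 1 (Matrix.of fun i j : Fin 1 => if i.val + j.val + 1 = 1 then (1 : L) else 0)).Local v)) [IsHaarMeasure νH] [νH.IsMulRightInvariant]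

/-- **THE `H_v` SOCKET AT A NON-SPLIT PLACE, FACTORED — `Φ([γ_H], 1_{K₂ ×ˢ K₁}; m_H) = #Fix_{γ₂}(U(Φ₂)_v ⧸ K₂)`**: for `m_H` canonical for `(IsLocalGRegular, ν_H)`,
`ν_H(K₂ ×ˢ K₁) = 1`, `γ_H = (γ₂, γ₁)` `G`-regular with `Z(γ₂) ⊆ U(Φ₂)_v` COMPACT (elliptic), and `v` NON-SPLIT (`c • w = w`): the `U(Φ₁)` factor is compact and equal to `K₁`
(§3–§4, `Φ₁ = (1)` a unit at `w` ★ `isUnit_placeForm_antidiagOne`), so `Z(γ_H) = Z(γ₂) × Z(γ₁)` is compact (§2) and the ★ socket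
`classOrbitalIntegral_indicator_cmLocalIntegralLevel_prod_eq_natCard_fixedBy` collapses to the `U(Φ₂)`-count (§4) — the quantity the (L5) count
[LabesseLanglands1979] evaluates. [cite: Rogawski1990, §4.9 Prop. 4.9.1 (b) p. 55; §4.3 (4.3.1) p. 43] [cite: Laumon1995, Lemma (5.3.2) p. 136] [cite: PlatonovRapinchuk1994, §5.1] -/
theorem classOrbitalIntegral_indicator_cmLocalIntegralLevel_prod_eq_natCard_fixedBy_fst
    {mH : OrbitalMeasureFamily ((cmDatum L 2 (Matrix.of fun i j : Fin 2 => if i.val + j.val + 1 = 2 then (1 : L) else 0)).Local v × (cmDatum L 1 (Matrix.of fun i j : Fin 1 => if i.val + j.val + 1 = 1 then (1 : L) else 0)).Local v)} (hmH : mH.IsCanonical (IsLocalGRegular L v) νH)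
    (hνH : νH (((cmLocalIntegralLevel L 2 (Matrix.of fun i j : Fin 2 => if i.val + j.val + 1 = 2 then (1 : L) else 0) v).prod (cmLocalIntegralLevel L 1 (Matrix.of fun i j : Fin 1 => if i.val + j.val + 1 = 1 then (1 : L) else 0) v) :
        Subgroup ((cmDatum L 2 (Matrix.of fun i j : Fin 2 => if i.val + j.val + 1 = 2 then (1 : L) else 0)).Local v × (cmDatum L 1 (Matrix.of fun i j : Fin 1 => if i.val + j.val + 1 = 1 then (1 : L) else 0)).Local v)) : Set ((cmDatum L 2 (Matrix.of fun i j : Fin 2 => if i.val + j.val + 1 = 2 then (1 : L) else 0)).Local v × (cmDatum L 1 (Matrix.of fun i j : Fin 1 => if i.val + j.val + 1 = 1 then (1 : L) else 0)).Local v)) = 1)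
    (γH : (cmDatum L 2 (Matrix.of fun i j : Fin 2 => if i.val + j.val + 1 = 2 then (1 : L) else 0)).Local v × (cmDatum L 1 (Matrix.of fun i j : Fin 1 => if i.val + j.val + 1 = 1 then (1 : L) else 0)).Local v) (hγ : IsLocalGRegular L v γH)
    [CompactSpace (Subgroup.centralizer ({γH.1} : Set ((cmDatum L 2 (Matrix.of fun i j : Fin 2 => if i.val + j.val + 1 = 2 then (1 : L) else 0)).Local v)))]
    (w : PlacesOver L v) (hw : IsCMField.complexConj L • w.1 = w.1) :
    classOrbitalIntegral mH ((((cmLocalIntegralLevel L 2 (Matrix.of fun i j : Fin 2 => if i.val + j.val + 1 = 2 then (1 : L) else 0) v).prod (cmLocalIntegralLevel L 1 (Matrix.of fun i j : Fin 1 => if i.val + j.val + 1 = 1 then (1 : L) else 0) v) :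
        Subgroup ((cmDatum L 2 (Matrix.of fun i j : Fin 2 => if i.val + j.val + 1 = 2 then (1 : L) else 0)).Local v × (cmDatum L 1 (Matrix.of fun i j : Fin 1 => if i.val + j.val + 1 = 1 then (1 : L) else 0)).Local v)) : Set ((cmDatum L 2 (Matrix.of fun i j : Fin 2 => if i.val + j.val + 1 = 2 then (1 : L) else 0)).Local v × (cmDatum L 1 (Matrix.of fun i j : Fin 1 => if i.val + j.val + 1 = 1 then (1 : L) else 0)).Local v)).indicator (1 : (cmDatum L 2 (Matrix.of fun i j : Fin 2 => if i.val + j.val + 1 = 2 then (1 : L) else 0)).Local v × (cmDatum L 1 (Matrix.of fun i j : Fin 1 => if i.val + j.val + 1 = 1 then (1 : L) else 0)).Local v → ℝ)) (ConjClasses.mk γH) =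
      (Nat.card (MulAction.fixedBy ((cmDatum L 2 (Matrix.of fun i j : Fin 2 => if i.val + j.val + 1 = 2 then (1 : L) else 0)).Local v ⧸ cmLocalIntegralLevel L 2 (Matrix.of fun i j : Fin 2 => if i.val + j.val + 1 = 2 then (1 : L) else 0) v) γH.1) : ℝ) := by
  haveI : CompactSpace ((cmDatum L 1 (Matrix.of fun i j : Fin 1 => if i.val + j.val + 1 = 1 then (1 : L) else 0)).Local v) :=
    compactSpace_cmDatum_local_one_of_smul_eq L (Matrix.of fun i j : Fin 1 => if i.val + j.val + 1 = 1 then (1 : L) else 0) w hw (isUnit_placeForm_antidiagOne (E := L) 1 w.1)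
  haveI : CompactSpace (Subgroup.centralizer ({γH.2} : Set ((cmDatum L 1 (Matrix.of fun i j : Fin 1 => if i.val + j.val + 1 = 1 then (1 : L) else 0)).Local v))) :=
    isCompact_iff_compactSpace.1 (isClosed_coe_centralizer_singleton γH.2).isCompact
  haveI : CompactSpace (Subgroup.centralizer ({γH} : Set ((cmDatum L 2 (Matrix.of fun i j : Fin 2 => if i.val + j.val + 1 = 2 then (1 : L) else 0)).Local v × (cmDatum L 1 (Matrix.of fun i j : Fin 1 => if i.val + j.val + 1 = 1 then (1 : L) else 0)).Local v))) :=
    compactSpace_centralizer_prod γH.1 γH.2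
  rw [classOrbitalIntegral_indicator_cmLocalIntegralLevel_prod_eq_natCard_fixedBy L v νH hmH hνH γH hγ,
    natCard_fixedBy_cmLocalIntegralLevel_prod_eq_of_smul_eq L 2 (Matrix.of fun i j : Fin 2 => if i.val + j.val + 1 = 2 then (1 : L) else 0) (Matrix.of fun i j : Fin 1 => if i.val + j.val + 1 = 1 then (1 : L) else 0) w hw (isUnit_placeForm_antidiagOne (E := L) 1 w.1) γH]

/-- **The factored `H_v` socket in the letter's `ℂ` currency**: `classOrbitalIntegral m_H (1_{K₂ ×ˢ K₁} : _ → ℂ) ⟦γ_H⟧ = #Fix_{γ₂}(U(Φ₂)_v ⧸ K₂)` at a non-split `v`.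
[cite: Rogawski1990, §4.9 Prop. 4.9.1 (b) p. 55] [cite: Laumon1995, Lemma (5.3.2) p. 136] -/
theorem classOrbitalIntegral_indicator_complex_cmLocalIntegralLevel_prod_eq_natCard_fixedBy_fst
    {mH : OrbitalMeasureFamily ((cmDatum L 2 (Matrix.of fun i j : Fin 2 => if i.val + j.val + 1 = 2 then (1 : L) else 0)).Local v × (cmDatum L 1 (Matrix.of fun i j : Fin 1 => if i.val + j.val + 1 = 1 then (1 : L) else 0)).Local v)} (hmH : mH.IsCanonical (IsLocalGRegular L v) νH)
    (hνH : νH (((cmLocalIntegralLevel L 2 (Matrix.of fun i j : Fin 2 => if i.val + j.val + 1 = 2 then (1 : L) else 0) v).prod (cmLocalIntegralLevel L 1 (Matrix.of fun i j : Fin 1 => if i.val + j.val + 1 = 1 then (1 : L) else 0) v) :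
        Subgroup ((cmDatum L 2 (Matrix.of fun i j : Fin 2 => if i.val + j.val + 1 = 2 then (1 : L) else 0)).Local v × (cmDatum L 1 (Matrix.of fun i j : Fin 1 => if i.val + j.val + 1 = 1 then (1 : L) else 0)).Local v)) : Set ((cmDatum L 2 (Matrix.of fun i j : Fin 2 => if i.val + j.val + 1 = 2 then (1 : L) else 0)).Local v × (cmDatum L 1 (Matrix.of fun i j : Fin 1 => if i.val + j.val + 1 = 1 then (1 : L) else 0)).Local v)) = 1)
    (γH : (cmDatum L 2 (Matrix.of fun i j : Fin 2 => if i.val + j.val + 1 = 2 then (1 : L) else 0)).Local v × (cmDatum L 1 (Matrix.of fun i j : Fin 1 => if i.val + j.val + 1 = 1 then (1 : L) else 0)).Local v) (hγ : IsLocalGRegular L v γH)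
    [CompactSpace (Subgroup.centralizer ({γH.1} : Set ((cmDatum L 2 (Matrix.of fun i j : Fin 2 => if i.val + j.val + 1 = 2 then (1 : L) else 0)).Local v)))]
    (w : PlacesOver L v) (hw : IsCMField.complexConj L • w.1 = w.1) :
    classOrbitalIntegral mH ((((cmLocalIntegralLevel L 2 (Matrix.of fun i j : Fin 2 => if i.val + j.val + 1 = 2 then (1 : L) else 0) v).prod (cmLocalIntegralLevel L 1 (Matrix.of fun i j : Fin 1 => if i.val + j.val + 1 = 1 then (1 : L) else 0) v) :
        Subgroup ((cmDatum L 2 (Matrix.of fun i j : Fin 2 => if i.val + j.val + 1 = 2 then (1 : L) else 0)).Local v × (cmDatum L 1 (Matrix.of fun i j : Fin 1 => if i.val + j.val + 1 = 1 then (1 : L) else 0)).Local v)) : Set ((cmDatum L 2 (Matrix.of fun i j : Fin 2 => if i.val + j.val + 1 = 2 then (1 : L) else 0)).Local v × (cmDatum L 1 (Matrix.of fun i j : Fin 1 => if i.val + j.val + 1 = 1 then (1 : L) else 0)).Local v)).indicator fun _ => (1 : ℂ)) (ConjClasses.mk γH) =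
      (Nat.card (MulAction.fixedBy ((cmDatum L 2 (Matrix.of fun i j : Fin 2 => if i.val + j.val + 1 = 2 then (1 : L) else 0)).Local v ⧸ cmLocalIntegralLevel L 2 (Matrix.of fun i j : Fin 2 => if i.val + j.val + 1 = 2 then (1 : L) else 0) v) γH.1) : ℂ) := by
  rw [classOrbitalIntegral_indicator_complex_eq_ofReal,
    classOrbitalIntegral_indicator_cmLocalIntegralLevel_prod_eq_natCard_fixedBy_fst L v νH hmH hνH γH hγ w hw, Complex.ofReal_natCast]

end H

end UnitaryGroup

end Literature.NumberTheory.Automorphic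

end
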